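import Mathlib.Data.Real.Basic
import Mathlib.Algebra.BigOperators.Ring.Finset
import Mathlib.Algebra.Order.BigOperators.Group.Finset
import Mathlib.Data.Fintype.BigOperators
import Mathlib.Data.Fintype.Powerset
import Mathlib.Logic.Equiv.Prod
import Mathlib.Tactic.Positivity
import Mathlib.Tactic.FieldSimp
import Mathlib.Tactic.Linarith
import Mathlib.Tactic.Ring
import HarnessLib

/-!
# The `p`-biased product measure on the subsets of a finite set

Elementary toolkit for probabilistic arguments over the subsets `W ⊆ X` of a finite type `X`
(`Fintype α`), with `W` distributed according to the product measure `μ_p`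
(each element lies in `W` independently with probability `p`), written as finite sums:

* `biasedWeight p W = p ^ |W| * (1 - p) ^ (|X| - |W|)` — the weight `μ_p(W)`;
* `biasedWeight_eq_prod` — the product formula `μ_p(W) = ∏ₐ (a ∈ W ? p : 1 - p)`;
* `sum_biasedWeight` — total mass `1`; `sum_biasedWeight_filter_subset` — `Pr[S ⊆ W] = p^{|S|}`;
* `sum_sum_biasedWeight_union` — the union of independent `μ_a`- and `μ_b`-random sets is
  `μ_c`-random with `1 - c = (1 - a)(1 - b)` (the standard coupling of product measures);
* `sum_biasedWeight_mono_of_monotone` — consequently `Pr_b[E] ≤ Pr_c[E]` for an up-closed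
  event `E` and `b ≤ c`; `mul_sum_biasedWeight_filter_lt_le` — Markov's inequality.

All statements are phrased with `Finset.sum` over `Finset α` (no measure theory), which is the
form in which they are consumed by the spread lemma (`SpreadLemma.lean`) and by the
approximation method for monotone circuits.

## Relation to Mathlib and the tree

The notion itself is not new: `biasedWeight p W` is the singleton mass of Mathlib's product
Bernoulli measure `ProbabilityTheory.setBernoulli` (`setBer(Set.univ, p)`, file
`Mathlib/Probability/Distributions/SetBernoulli.lean`; `setBernoulli_real_singleton` reads
`p ^ |s| * (1 - p) ^ |u \ s|`, and `SimpleGraph.binomialRandom` is built on it), written as a real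
number indexed by a `Finset` and for an arbitrary real parameter `p`. Mathlib's API stops at the
weights and their normalisation; the marginal, union-coupling, monotone-comparison and Markov
statements below are needed as identities/inequalities of finite sums (they are summed against
combinatorial counts in `SpreadLemma*.lean`), which is why the elementary sum form is kept here
rather than the `Measure (Set α)` form (a bridge lemma to `setBer(Set.univ, p).real {↑W}` for
`p : unitInterval` is deliberately not included). `Fin`-indexed relatives already in the tree:
`Literature.Barriers.PneNP.bernoulliSeqWeight` (`Barriers/PneNP/ZoomTheorem.lean`),
`Literature.Computability.Complexity.bernoulliWeight` (`ArthurMerlinParallelPlay.lean`),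
`Literature.Computability.Complexity.subsetWeight` (`FourierTails.lean`, the case `α = Fin m`
with the roles of `p` and `1 - p` swapped), and the support bijection
`Literature.Computability.Complexity.boolFunEquivFinset` (`LindseyLemma.lean`), which is the
inverse of `finsetEquivFun` below (kept local to avoid importing Fourier-analytic material into
this elementary file). The pair-splitting equivalence used in the union coupling is Mathlib's
`Equiv.arrowProdEquivProdArrow`.

## References

Standard material, e.g. S. Janson, T. Łuczak, A. Ruciński, *Random Graphs* (2000), §1.1
(the binomial model and the monotone two-round coupling). [folklore]
-/

namespace Literature.Combinatorics.SetFamily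

open Finset

variable {α : Type*} [Fintype α] [DecidableEq α]

/-! ### The weight of a subset -/

/-- The `p`-biased weight `μ_p(W) = p^{|W|} (1-p)^{|X| - |W|}` of a subset `W` of the finite
ground type `X = α`. [folklore] -/
def biasedWeight (p : ℝ) (W : Finset α) : ℝ := p ^ #W * (1 - p) ^ (Fintype.card α - #W)

omit [DecidableEq α] in
/-- Biased weights are nonnegative for `p ∈ [0, 1]`. [folklore] -/
theorem biasedWeight_nonneg {p : ℝ} (h0 : 0 ≤ p) (h1 : p ≤ 1) (W : Finset α) :
    0 ≤ biasedWeight p W := by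
  unfold biasedWeight
  have : 0 ≤ 1 - p := by linarith
  positivity

/-- `μ_0` is the point mass at `∅`. [folklore] -/
theorem biasedWeight_zero (W : Finset α) : biasedWeight 0 W = if W = ∅ then 1 else 0 := by
  unfold biasedWeight
  by_cases hW : W = ∅
  · simp [hW]
  · have : #W ≠ 0 := fun h => hW (card_eq_zero.1 h)
    simp [hW, zero_pow this]

/-- The Bernoulli factor of one coordinate: `p` if present, `1 - p` if absent. [folklore] -/
def bern (p : ℝ) (b : Bool) : ℝ := if b then p else 1 - p

/-- The Bernoulli factors sum to one. [folklore] -/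
@[simp] theorem bern_true_add_bern_false (p : ℝ) : bern p true + bern p false = 1 := by
  simp [bern]

/-- Sum of a product of independent factors over all Boolean assignments factorises
(Fubini for the product measure). [folklore] -/
theorem sum_prod_bern_mul (p : ℝ) (φ : α → Bool → ℝ) :
    ∑ f : α → Bool, ∏ a, bern p (f a) * φ a (f a) = ∏ a, (p * φ a true + (1 - p) * φ a false) := by
  have h := Finset.prod_univ_sum (fun _ : α => (univ : Finset Bool)) fun a b => bern p b * φ a b
  rw [Fintype.piFinset_univ] at h
  rw [← h]
  refine Finset.prod_congr rfl fun a _ => ?_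
  simp [bern]

/-- The bijection between subsets of `α` and Boolean assignments (indicator functions).
[folklore] -/
def finsetEquivFun : Finset α ≃ (α → Bool) where
  toFun W a := decide (a ∈ W)
  invFun f := univ.filter fun a => f a = true
  left_inv W := by ext a; simp
  right_inv f := by funext a; simp

/-- Membership in the subset of an assignment. [folklore] -/
@[simp] theorem mem_finsetEquivFun_symm (f : α → Bool) (a : α) :
    a ∈ finsetEquivFun.symm f ↔ f a = true := by
  change a ∈ univ.filter (fun a => f a = true) ↔ _
  simp

/-- The indicator of the subset of an assignment is the assignment. [folklore] -/
@[simp] theorem decide_mem_finsetEquivFun_symm (f : α → Bool) (a : α) :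
    decide (a ∈ finsetEquivFun.symm f) = f a := by
  rcases h : f a with _ | _ <;> simp [h]

/-- **Product formula**: `μ_p(W) = ∏ₐ bern p (a ∈ W)`. [folklore] -/
theorem biasedWeight_eq_prod (p : ℝ) (W : Finset α) :
    biasedWeight p W = ∏ a, bern p (decide (a ∈ W)) := by
  have h : ∀ a, bern p (decide (a ∈ W)) = if a ∈ W then p else 1 - p := fun a => by
    by_cases ha : a ∈ W <;> simp [bern, ha]
  simp_rw [h]
  rw [Finset.prod_ite, Finset.prod_const, Finset.prod_const, Finset.filter_mem_eq_inter,
    Finset.univ_inter, Finset.filter_not, Finset.filter_mem_eq_inter, Finset.univ_inter,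
    Finset.card_univ_sdiff]
  rfl

/-- Transfer of a sum over subsets to a sum over assignments. [folklore] -/
theorem sum_finset_eq_sum_fun (F : Finset α → ℝ) :
    ∑ W : Finset α, F W = ∑ f : α → Bool, F (finsetEquivFun.symm f) :=
  (Fintype.sum_equiv finsetEquivFun.symm _ _ fun _ => rfl).symm

/-- **Expectation of a product function**: `E_p[∏ₐ φ a (a ∈ W)] = ∏ₐ (p φ a 1 + (1-p) φ a 0)`.
[folklore] -/
theorem sum_biasedWeight_mul_prod (p : ℝ) (φ : α → Bool → ℝ) :
    ∑ W : Finset α, biasedWeight p W * ∏ a, φ a (decide (a ∈ W))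
      = ∏ a, (p * φ a true + (1 - p) * φ a false) := by
  rw [sum_finset_eq_sum_fun]
  refine Eq.trans (Finset.sum_congr rfl fun f _ => ?_) (sum_prod_bern_mul p φ)
  rw [biasedWeight_eq_prod, ← Finset.prod_mul_distrib]
  refine Finset.prod_congr rfl fun a _ => ?_
  rw [decide_mem_finsetEquivFun_symm]

/-- **Total mass**: `∑_W μ_p(W) = 1`. [folklore] -/
theorem sum_biasedWeight (p : ℝ) : ∑ W : Finset α, biasedWeight p W = 1 := by
  have h := sum_biasedWeight_mul_prod (α := α) p fun _ _ => 1
  simp only [Finset.prod_const_one, mul_one] at h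
  rw [h]
  exact Finset.prod_eq_one fun a _ => by ring

/-- **Marginals**: `Pr_p[S ⊆ W] = p^{|S|}`. [folklore] -/
theorem sum_biasedWeight_filter_subset (p : ℝ) (S : Finset α) :
    ∑ W ∈ univ.filter (fun W : Finset α => S ⊆ W), biasedWeight p W = p ^ #S := by
  set φ : α → Bool → ℝ := fun a b => if a ∈ S then (if b then 1 else 0) else 1 with hφ
  have hprod : ∀ W : Finset α, (∏ a, φ a (decide (a ∈ W))) = if S ⊆ W then 1 else 0 := by
    intro W
    have : ∀ a, φ a (decide (a ∈ W)) = if a ∈ S then (if a ∈ W then (1 : ℝ) else 0) else 1 := by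
      intro a
      by_cases ha : a ∈ S <;> by_cases hw : a ∈ W <;> simp [hφ, ha, hw]
    simp_rw [this]
    rw [Finset.prod_ite_mem, Finset.univ_inter, Finset.prod_boole]
    by_cases hSW : S ⊆ W
    · rw [if_pos hSW, if_pos fun a ha => hSW ha]
    · rw [if_neg hSW, if_neg fun h => hSW fun a ha => h a ha]
  have h := sum_biasedWeight_mul_prod (α := α) p φ
  simp_rw [hprod] at h
  rw [Finset.sum_filter]
  have hL : ∑ W : Finset α, (if S ⊆ W then biasedWeight p W else 0)
      = ∑ W : Finset α, biasedWeight p W * (if S ⊆ W then 1 else 0) := by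
    refine Finset.sum_congr rfl fun W _ => ?_
    split_ifs <;> simp
  rw [hL, h]
  have hR : ∀ a, (p * φ a true + (1 - p) * φ a false) = if a ∈ S then p else 1 := by
    intro a
    by_cases ha : a ∈ S <;> simp [hφ, ha]
  simp_rw [hR]
  rw [Finset.prod_ite_mem, Finset.univ_inter, Finset.prod_const]

/-- The Bernoulli factors of the union coupling: summing `bern a s * bern b t` over the pairs
with `s ∨ t = u` gives `bern c u` with `c = a + b - a b`. [folklore] -/
theorem sum_bern_mul_bern_or (a b : ℝ) (u : Bool) :
    ∑ st ∈ (univ : Finset (Bool × Bool)).filter (fun st => (st.1 || st.2) = u),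
      bern a st.1 * bern b st.2 = bern (a + b - a * b) u := by
  rw [Finset.sum_filter, Fintype.sum_prod_type]
  simp only [Fintype.sum_bool]
  cases u <;> simp [bern] <;> ring

/-- **Union of independent biased sets**: if `W ∼ μ_a` and `U ∼ μ_b` are independent then
`W ∪ U ∼ μ_c` with `1 - c = (1 - a)(1 - b)`, i.e. `c = a + b - ab`; stated as an identity of
finite sums valid for all real `a, b`. [folklore] -/
theorem sum_sum_biasedWeight_union (a b : ℝ) (g : Finset α → ℝ) :
    ∑ W : Finset α, ∑ U : Finset α, biasedWeight a W * biasedWeight b U * g (W ∪ U)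
      = ∑ V : Finset α, biasedWeight (a + b - a * b) V * g V := by
  set c := a + b - a * b with hc
  -- pass to assignments
  have hunion : ∀ f₁ f₂ : α → Bool,
      finsetEquivFun.symm f₁ ∪ finsetEquivFun.symm f₂ = finsetEquivFun.symm fun x => f₁ x || f₂ x := by
    intro f₁ f₂
    ext x
    simp
  have hL : ∑ W : Finset α, ∑ U : Finset α, biasedWeight a W * biasedWeight b U * g (W ∪ U)
      = ∑ F : α → Bool × Bool, (∏ x, bern a (F x).1 * bern b (F x).2)
          * g (finsetEquivFun.symm fun x => (F x).1 || (F x).2) := by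
    rw [sum_finset_eq_sum_fun]
    simp_rw [sum_finset_eq_sum_fun (fun U => biasedWeight a _ * biasedWeight b U * g (_ ∪ U))]
    rw [← Fintype.sum_prod_type',
      ← (Equiv.arrowProdEquivProdArrow α (fun _ => Bool) (fun _ => Bool)).sum_comp]
    refine Finset.sum_congr rfl fun F _ => ?_
    change biasedWeight a (finsetEquivFun.symm fun x => (F x).1)
        * biasedWeight b (finsetEquivFun.symm fun x => (F x).2)
        * g (finsetEquivFun.symm (fun x => (F x).1) ∪ finsetEquivFun.symm fun x => (F x).2) = _
    rw [hunion, biasedWeight_eq_prod, biasedWeight_eq_prod, ← Finset.prod_mul_distrib]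
    congr 1
    refine Finset.prod_congr rfl fun x _ => ?_
    rw [decide_mem_finsetEquivFun_symm, decide_mem_finsetEquivFun_symm]
  have hR : ∑ V : Finset α, biasedWeight c V * g V
      = ∑ h : α → Bool, (∏ x, bern c (h x)) * g (finsetEquivFun.symm h) := by
    rw [sum_finset_eq_sum_fun]
    refine Finset.sum_congr rfl fun h _ => ?_
    rw [biasedWeight_eq_prod]
    congr 1
    refine Finset.prod_congr rfl fun x _ => ?_
    rw [decide_mem_finsetEquivFun_symm]
  rw [hL, hR]
  -- group the assignments `F` by their pointwise disjunction `h`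
  rw [← Finset.sum_fiberwise_of_maps_to (s := (univ : Finset (α → Bool × Bool)))
    (t := (univ : Finset (α → Bool))) (g := fun F x => (F x).1 || (F x).2) (fun _ _ => mem_univ _)]
  refine Finset.sum_congr rfl fun h _ => ?_
  set t : α → Finset (Bool × Bool) := fun x => (univ : Finset (Bool × Bool)).filter
    fun st => (st.1 || st.2) = h x with ht
  have hfib : (univ : Finset (α → Bool × Bool)).filter (fun F => (fun x => (F x).1 || (F x).2) = h)
      = Fintype.piFinset t := by
    ext F
    simp only [Finset.mem_filter, Finset.mem_univ, true_and, Fintype.mem_piFinset, ht]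
    exact funext_iff
  rw [Finset.sum_congr rfl (g := fun F => (∏ x, bern a (F x).1 * bern b (F x).2)
      * g (finsetEquivFun.symm h)) fun F hF => by rw [(Finset.mem_filter.1 hF).2]]
  rw [← Finset.sum_mul, hfib]
  congr 1
  exact (Finset.prod_univ_sum t (fun x st => bern a st.1 * bern b st.2)).symm.trans
    (Finset.prod_congr rfl fun x _ => sum_bern_mul_bern_or a b (h x))

/-- **Monotone coupling**: for an up-closed event `E` and `0 ≤ b ≤ c ≤ 1`,
`Pr_b[E] ≤ Pr_c[E]`. [folklore] -/
theorem sum_biasedWeight_mono_of_monotone {b c : ℝ} (hb0 : 0 ≤ b) (hbc : b ≤ c) (hc1 : c ≤ 1)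
    (E : Finset α → Prop) [DecidablePred E] (hE : ∀ W U : Finset α, E W → W ⊆ U → E U) :
    ∑ W ∈ univ.filter E, biasedWeight b W ≤ ∑ W ∈ univ.filter E, biasedWeight c W := by
  rcases eq_or_lt_of_le (hbc.trans hc1) with hb1 | hb1
  · -- `b = 1 = c`
    have : c = 1 := le_antisymm hc1 (hb1 ▸ hbc)
    rw [hb1, this]
  -- write `μ_c` as the union of a `μ_b`- and an independent `μ_a`-random set
  set a := (c - b) / (1 - b) with ha
  have h1b : 0 < 1 - b := by linarith
  have ha0 : 0 ≤ a := div_nonneg (by linarith) h1b.le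
  have ha1 : a ≤ 1 := by rw [ha, div_le_one h1b]; linarith
  have hcab : b + a - b * a = c := by
    rw [ha]; field_simp; ring
  have key := sum_sum_biasedWeight_union (α := α) b a fun V => if E V then 1 else 0
  rw [hcab] at key
  rw [Finset.sum_filter, Finset.sum_filter]
  simp only [mul_ite, mul_one, mul_zero] at key
  rw [← key]
  refine Finset.sum_le_sum fun W _ => ?_
  by_cases hW : E W
  · rw [if_pos hW]
    calc biasedWeight b W = ∑ U : Finset α, biasedWeight b W * biasedWeight a U := by
          rw [← Finset.mul_sum, sum_biasedWeight, mul_one]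
      _ = ∑ U : Finset α, (if E (W ∪ U) then biasedWeight b W * biasedWeight a U else 0) := by
          refine Finset.sum_congr rfl fun U _ => ?_
          rw [if_pos (hE W (W ∪ U) hW subset_union_left)]
      _ ≤ _ := le_rfl
  · rw [if_neg hW]
    exact Finset.sum_nonneg fun U _ => by
      split_ifs
      · exact mul_nonneg (biasedWeight_nonneg hb0 (hbc.trans hc1) W) (biasedWeight_nonneg ha0 ha1 U)
      · exact le_rfl

omit [DecidableEq α] in
/-- **Markov's inequality** for the biased measure, in the form used for success/failure
criteria: `θ · Pr_p[θ < f] ≤ E_p[f]` for `f ≥ 0`. [folklore] -/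
theorem mul_sum_biasedWeight_filter_lt_le {p : ℝ} (hp0 : 0 ≤ p) (hp1 : p ≤ 1) (θ : ℝ)
    (f : Finset α → ℝ) (hf : ∀ W, 0 ≤ f W) :
    θ * ∑ W ∈ univ.filter (fun W => θ < f W), biasedWeight p W
      ≤ ∑ W : Finset α, biasedWeight p W * f W := by
  rw [Finset.mul_sum]
  calc ∑ W ∈ univ.filter (fun W => θ < f W), θ * biasedWeight p W
      ≤ ∑ W ∈ univ.filter (fun W => θ < f W), biasedWeight p W * f W := by
        refine Finset.sum_le_sum fun W hW => ?_
        rw [mul_comm]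
        exact mul_le_mul_of_nonneg_left (le_of_lt (Finset.mem_filter.1 hW).2)
          (biasedWeight_nonneg hp0 hp1 W)
    _ ≤ ∑ W : Finset α, biasedWeight p W * f W :=
        Finset.sum_le_sum_of_subset_of_nonneg (Finset.filter_subset _ _) fun W _ _ =>
          mul_nonneg (biasedWeight_nonneg hp0 hp1 W) (hf W)

end Literature.Combinatorics.SetFamily
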